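import Mathlib
import Literature.Analysis.FluidPDE.VectorCalculus
import Literature.Analysis.FluidPDE.BiotSavartCurlPair
import Summits.NavierStokesRegularity.NavierStokesRegularity.Theorems.ThreadingFluxCentreJetDefs
import Summits.NavierStokesRegularity.NavierStokesRegularity.Theorems.LandauTailHomSteadyProfileExistsCalculus
import Literature.Analysis.FluidPDE.AxisymmetricEuler
import Literature.Analysis.FluidPDE.SwirlTransportProofs
import Literature.Analysis.FluidPDE.AxisymGradientField
import Summits.NavierStokesRegularity.NavierStokesRegularity.Theorems.ThreadingFluxAzimuthalCartanDefs
import Summits.NavierStokesRegularity.NavierStokesRegularity.Theorems.ThreadingFluxAzimuthalCartanLandauBaseTools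
import HarnessLib

/-!
# Crux `PoloidalLiouville` (stmt-NavierStokesRegularity-1222, W1), crux idea «azimuthal-cartan-test» (ns-idea-15 g10, V26):
# V♯ witness — the explicit GRADIENT of the mode-2 potential `θ`

Brick for the two remaining conjuncts of V♯ `LandauVertexFlexibility` for the explicit conformal-derivative witness
(`Cruxes/PoloidalLiouville/AzimuthalCartanVertexWitness.md`; landed bricks `ThreadingFluxAzimuthalCartanVertexWitness.lean`, p709113 —
not imported here so that this file builds independently of the farm's olean queue):
with `r = |x|`, `A(x) = (10r − 8x₂)/((r − x₂)²(2r − x₂))` and `θ = (x₀² − x₁²)·A`,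

* `hasFDerivAt_A` / `fderiv_A_apply` — the directional derivative of `A` off the closed positive `e₂`-ray, in closed form
  (`DA(x)v = (10⟪x,v⟫/r − 8v₂)/M − N·DM(x)v/M²`, `N = 10r − 8x₂`, `M = (r − x₂)²(2r − x₂)`,
  `DM(x)v = 2(r − x₂)(2r − x₂)(⟪x,v⟫/r − v₂) + (r − x₂)²(2⟪x,v⟫/r − v₂)`);
* `fderiv_theta_apply` — `Dθ(x)v = (2x₀v₀ − 2x₁v₁)·A(x) + (x₀² − x₁²)·DA(x)v`;

first-order facts only (product/quotient rules over the tree's `LandauTail.hasFDerivAt_norm_of_ne_zero`).  They feed (i) the pointwise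
evaluation of the Lie derivative of the witness at the symmetry points `(3,0,4)`, `(0,3,4)` (non-equivariance via `LieTilt`) and (ii) any
future verification of the linearised momentum identity.  `PoloidalLiouville` (1222), V♯ and NS regularity stay OPEN / NOT proved.
`--supports stmt-NavierStokesRegularity-1222 --as helper`; 0 kit.  [folklore]
-/

-- the summit and its single problem share the name (D-0017 nested layout)
set_option linter.dupNamespace false

noncomputable section

open Set Function Metric
open scoped RealInnerProductSpace
open Literature.Analysis.FluidPDE

namespace Summit.NavierStokesRegularity.NavierStokesRegularity.Theorems.PoloidalLiouville.AzimuthalCartan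

open Summit.NavierStokesRegularity.NavierStokesRegularity.Theorems.PoloidalLiouville.CentreJet (E3)
open Summit.NavierStokesRegularity.NavierStokesRegularity.Theorems.LandauTail (hasFDerivAt_norm_of_ne_zero)

namespace VertexWitness

/-- **Directional derivative of the radial–axial profile `A = (10r − 8x₂)/((r − x₂)²(2r − x₂))`** off the closed positive `e₂`-ray
(`|x| ≠ x₂`). [folklore] -/
theorem fderiv_A_apply {x : E3} (hx : ‖x‖ ≠ x 2) (v : E3) :
    fderiv ℝ (fun y : E3 => (10 * ‖y‖ - 8 * y 2) / ((‖y‖ - y 2) ^ 2 * (2 * ‖y‖ - y 2))) x v =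
      (10 * (‖x‖⁻¹ * ⟪x, v⟫) - 8 * v 2) * ((‖x‖ - x 2) ^ 2 * (2 * ‖x‖ - x 2))⁻¹ +
        (10 * ‖x‖ - 8 * x 2) *
          (-(((‖x‖ - x 2) ^ 2 * (2 * ‖x‖ - x 2)) ^ 2)⁻¹ *
            ((‖x‖ - x 2) ^ 2 * (2 * (‖x‖⁻¹ * ⟪x, v⟫) - v 2) +
              (2 * ‖x‖ - x 2) * ((‖x‖ - x 2) * (‖x‖⁻¹ * ⟪x, v⟫ - v 2) + (‖x‖ - x 2) * (‖x‖⁻¹ * ⟪x, v⟫ - v 2)))) := by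
  have hle : x 2 ≤ ‖x‖ := (le_abs_self _).trans (by simpa using PiLp.norm_apply_le x 2)
  have h0 : x ≠ 0 := fun h => hx (by rw [h]; simp)
  have h1 : ‖x‖ - x 2 ≠ 0 := sub_ne_zero.2 hx
  have h2 : 2 * ‖x‖ - x 2 ≠ 0 := by
    intro h
    have : ‖x‖ = 0 := by linarith [norm_nonneg x]
    rw [norm_eq_zero] at this
    exact hx (by rw [this]; simp)
  have hn : HasFDerivAt (fun y : E3 => ‖y‖) (‖x‖⁻¹ • (innerSL ℝ x : E3 →L[ℝ] ℝ)) x := hasFDerivAt_norm_of_ne_zero h0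
  have h2c : HasFDerivAt (fun y : E3 => y 2) (EuclideanSpace.proj 2 : E3 →L[ℝ] ℝ) x :=
    (EuclideanSpace.proj (2 : Fin 3) : E3 →L[ℝ] ℝ).hasFDerivAt
  have hN : HasFDerivAt (fun y : E3 => 10 * ‖y‖ - 8 * y 2)
      ((10 : ℝ) • (‖x‖⁻¹ • (innerSL ℝ x : E3 →L[ℝ] ℝ)) - (8 : ℝ) • (EuclideanSpace.proj 2 : E3 →L[ℝ] ℝ)) x :=
    (hn.const_mul 10).sub (h2c.const_mul 8)
  have hD1 : HasFDerivAt (fun y : E3 => ‖y‖ - y 2)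
      (‖x‖⁻¹ • (innerSL ℝ x : E3 →L[ℝ] ℝ) - (EuclideanSpace.proj 2 : E3 →L[ℝ] ℝ)) x := hn.sub h2c
  have hD2 : HasFDerivAt (fun y : E3 => 2 * ‖y‖ - y 2)
      ((2 : ℝ) • (‖x‖⁻¹ • (innerSL ℝ x : E3 →L[ℝ] ℝ)) - (EuclideanSpace.proj 2 : E3 →L[ℝ] ℝ)) x :=
    (hn.const_mul 2).sub h2c
  have hM : HasFDerivAt (fun y : E3 => (‖y‖ - y 2) ^ 2 * (2 * ‖y‖ - y 2)) _ x := ((hD1.mul hD1).congr_of_eventuallyEq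
    (Filter.Eventually.of_forall fun y => (sq (‖y‖ - y 2)))).mul hD2
  have hM0 : (‖x‖ - x 2) ^ 2 * (2 * ‖x‖ - x 2) ≠ 0 := mul_ne_zero (pow_ne_zero 2 h1) h2
  have hMinv := (hasDerivAt_inv hM0).comp_hasFDerivAt x hM
  have hA := hN.mul hMinv
  have e : (fun y : E3 => (10 * ‖y‖ - 8 * y 2) / ((‖y‖ - y 2) ^ 2 * (2 * ‖y‖ - y 2))) =
      (fun y : E3 => 10 * ‖y‖ - 8 * y 2) * ((fun t : ℝ => t⁻¹) ∘ fun y : E3 => (‖y‖ - y 2) ^ 2 * (2 * ‖y‖ - y 2)) := by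
    funext y; simp only [Pi.mul_apply, Function.comp_apply, div_eq_mul_inv]
  rw [e, hA.fderiv]
  simp only [add_apply, smul_apply, sub_apply, innerSL_apply_apply, smul_eq_mul, Function.comp_apply, sq]
  simp
  ring

/-- **Directional derivative of the mode-2 potential `θ = (x₀² − x₁²)·A`** off the ray:
`Dθ(x)v = (2x₀v₀ − 2x₁v₁)·A(x) + (x₀² − x₁²)·DA(x)v`. [folklore] -/
theorem fderiv_theta_apply {x : E3} (hx : ‖x‖ ≠ x 2) (v : E3) :
    fderiv ℝ (fun y : E3 => (y 0 ^ 2 - y 1 ^ 2) * (10 * ‖y‖ - 8 * y 2) / ((‖y‖ - y 2) ^ 2 * (2 * ‖y‖ - y 2))) x v =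
      (2 * x 0 * v 0 - 2 * x 1 * v 1) * ((10 * ‖x‖ - 8 * x 2) / ((‖x‖ - x 2) ^ 2 * (2 * ‖x‖ - x 2))) +
        (x 0 ^ 2 - x 1 ^ 2) *
          fderiv ℝ (fun y : E3 => (10 * ‖y‖ - 8 * y 2) / ((‖y‖ - y 2) ^ 2 * (2 * ‖y‖ - y 2))) x v := by
  have hle : x 2 ≤ ‖x‖ := (le_abs_self _).trans (by simpa using PiLp.norm_apply_le x 2)
  have h0 : x ≠ 0 := fun h => hx (by rw [h]; simp)
  have h1 : ‖x‖ - x 2 ≠ 0 := sub_ne_zero.2 hx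
  have h2 : 2 * ‖x‖ - x 2 ≠ 0 := by
    intro h
    have : ‖x‖ = 0 := by linarith [norm_nonneg x]
    rw [norm_eq_zero] at this
    exact hx (by rw [this]; simp)
  have hQ : HasFDerivAt (fun y : E3 => y 0 * y 0 - y 1 * y 1)
      ((x 0 • (EuclideanSpace.proj 0 : E3 →L[ℝ] ℝ) + x 0 • (EuclideanSpace.proj 0 : E3 →L[ℝ] ℝ)) -
        (x 1 • (EuclideanSpace.proj 1 : E3 →L[ℝ] ℝ) + x 1 • (EuclideanSpace.proj 1 : E3 →L[ℝ] ℝ))) x :=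
    (((EuclideanSpace.proj (0 : Fin 3) : E3 →L[ℝ] ℝ).hasFDerivAt).mul
      ((EuclideanSpace.proj (0 : Fin 3) : E3 →L[ℝ] ℝ).hasFDerivAt)).sub
      (((EuclideanSpace.proj (1 : Fin 3) : E3 →L[ℝ] ℝ).hasFDerivAt).mul
        ((EuclideanSpace.proj (1 : Fin 3) : E3 →L[ℝ] ℝ).hasFDerivAt))
  have hAd : DifferentiableAt ℝ (fun y : E3 => (10 * ‖y‖ - 8 * y 2) / ((‖y‖ - y 2) ^ 2 * (2 * ‖y‖ - y 2))) x := by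
    have hn : ContDiffAt ℝ 1 (fun y : E3 => ‖y‖) x := contDiffAt_norm ℝ h0
    have hc2 : ContDiffAt ℝ 1 (fun y : E3 => y 2) x := (EuclideanSpace.proj (2 : Fin 3) : E3 →L[ℝ] ℝ).contDiff.contDiffAt
    have h : ContDiffAt ℝ 1 (fun y : E3 => (10 * ‖y‖ - 8 * y 2) / ((‖y‖ - y 2) ^ 2 * (2 * ‖y‖ - y 2))) x :=
      ((contDiffAt_const.mul hn).sub (contDiffAt_const.mul hc2)).div
        (((hn.sub hc2).pow 2).mul ((contDiffAt_const.mul hn).sub hc2)) (mul_ne_zero (pow_ne_zero 2 h1) h2)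
    exact h.differentiableAt one_ne_zero
  have e : (fun y : E3 => (y 0 ^ 2 - y 1 ^ 2) * (10 * ‖y‖ - 8 * y 2) / ((‖y‖ - y 2) ^ 2 * (2 * ‖y‖ - y 2))) =
      fun y : E3 => (y 0 * y 0 - y 1 * y 1) * ((10 * ‖y‖ - 8 * y 2) / ((‖y‖ - y 2) ^ 2 * (2 * ‖y‖ - y 2))) := by
    funext y; ring
  rw [e, fderiv_fun_mul hQ.differentiableAt hAd, hQ.fderiv]
  simp only [add_apply, smul_apply, sub_apply, smul_eq_mul]
  simp
  ring


/-! ## (v2, appended) The azimuthal Lie derivative of the witness at the mirror points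

Behind V♯'s last clause («not tilt + `J₃`-equivariant») for the explicit witness: off the axis ray `∂₁θ = x₁·E(x)` and
`(δv x)₁ = x₁·(E + g)(x)` with an explicit smooth cofactor (`fderiv_theta_single_one`, `witness_apply_one`, `contDiffAt_cofactor`), so in the
symmetry plane `x₁ = 0` the azimuthal derivative of `(δv)₁` is the cofactor itself; `differentiableAt_witness` (`θ ∈ C²`, `g ∈ C¹` off the
ray); ★ `lie_witness_apply_one`: at the mirror points `q_s = (3s, 0, 4)`, `s = ±1`, of the centre circle of `landauTorus`,
`(Dδv(q_s)(J₃ q_s) − J₃ δv(q_s))₁ = −36·s` — ODD under `x₀ ↦ −x₀` (exact arithmetic: `r = 5`, `A = 3`, `θ = 27`, `∂₁₁θ = −78/5`,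
`∂₀θ = ∓54/5`).  The tilt side (`(tilt landau2 0 (J₃Ω) q_s)₁ = Ω₁/3`, EVEN) is `…VertexWitnessMirrorTilt.lean`; the assembly with
`LieTilt.lieJ3_of_sub_tilt_equivariant` (`−36 = −Ω₁/3 = 36` ⊥) is the sequel.  V♯'s `LinearisedSteadyNSOn` clause stays the (L) residual;
`PoloidalLiouville` (1222), W1, NS regularity stay OPEN / NOT proved. -/

open scoped Topology
open Summit.NavierStokesRegularity.NavierStokesRegularity.Theorems

/-- The complement of the closed ray `{|x| = x₂}` is open. [folklore] -/
theorem isOpen_offRay : IsOpen {x : E3 | ‖x‖ ≠ x 2} :=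
  isOpen_ne_fun continuous_norm (EuclideanSpace.proj (2 : Fin 3) : E3 →L[ℝ] ℝ).continuous

/-- Off the ray, `∂₁θ(x) = x₁ · E(x)` with the explicit cofactor
`E = −2A + (x₀² − x₁²)·|x|⁻¹·(10 M⁻¹ − N M⁻² (2m₁² + 2 m₂ m₁))`, `N = 10|x| − 8x₂`, `m₁ = |x| − x₂`, `m₂ = 2|x| − x₂`, `M = m₁² m₂`,
`A = N/M`. [folklore] -/
theorem fderiv_theta_single_one {x : E3} (hx : ‖x‖ ≠ x 2) :
    fderiv ℝ (fun y : E3 => (y 0 ^ 2 - y 1 ^ 2) * (10 * ‖y‖ - 8 * y 2) / ((‖y‖ - y 2) ^ 2 * (2 * ‖y‖ - y 2))) x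
        (EuclideanSpace.single 1 1) =
      x 1 * (-2 * ((10 * ‖x‖ - 8 * x 2) / ((‖x‖ - x 2) ^ 2 * (2 * ‖x‖ - x 2))) +
        (x 0 ^ 2 - x 1 ^ 2) * (‖x‖⁻¹ * (10 * ((‖x‖ - x 2) ^ 2 * (2 * ‖x‖ - x 2))⁻¹ +
          (10 * ‖x‖ - 8 * x 2) * (-(((‖x‖ - x 2) ^ 2 * (2 * ‖x‖ - x 2)) ^ 2)⁻¹) *
            (2 * (‖x‖ - x 2) ^ 2 + 2 * ((2 * ‖x‖ - x 2) * (‖x‖ - x 2)))))) := by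
  rw [fderiv_theta_apply hx, fderiv_A_apply hx]
  have i1 : ⟪x, (EuclideanSpace.single 1 1 : E3)⟫ = x 1 := by rw [EuclideanSpace.inner_single_right]; simp
  rw [i1]
  simp
  ring

/-- Off the ray, the `e₁`-component of the witness `δv = ∇θ + g·id` factors through `x₁`:
`(δv x)₁ = x₁ · (E(x) + g(x))`. [folklore] -/
theorem witness_apply_one {x : E3} (hx : ‖x‖ ≠ x 2) :
    (gradient (fun y : E3 => (y 0 ^ 2 - y 1 ^ 2) * (10 * ‖y‖ - 8 * y 2) / ((‖y‖ - y 2) ^ 2 * (2 * ‖y‖ - y 2))) x +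
        (6 * ((x 0 ^ 2 - x 1 ^ 2) * (10 * ‖x‖ - 8 * x 2) / ((‖x‖ - x 2) ^ 2 * (2 * ‖x‖ - x 2))) /
          (2 * ‖x‖ - x 2) ^ 2) • x) 1 =
      x 1 * (-2 * ((10 * ‖x‖ - 8 * x 2) / ((‖x‖ - x 2) ^ 2 * (2 * ‖x‖ - x 2))) +
        (x 0 ^ 2 - x 1 ^ 2) * (‖x‖⁻¹ * (10 * ((‖x‖ - x 2) ^ 2 * (2 * ‖x‖ - x 2))⁻¹ +
          (10 * ‖x‖ - 8 * x 2) * (-(((‖x‖ - x 2) ^ 2 * (2 * ‖x‖ - x 2)) ^ 2)⁻¹) *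
            (2 * (‖x‖ - x 2) ^ 2 + 2 * ((2 * ‖x‖ - x 2) * (‖x‖ - x 2))))) +
        6 * ((x 0 ^ 2 - x 1 ^ 2) * (10 * ‖x‖ - 8 * x 2) / ((‖x‖ - x 2) ^ 2 * (2 * ‖x‖ - x 2))) /
          (2 * ‖x‖ - x 2) ^ 2) := by
  rw [PiLp.add_apply, PiLp.smul_apply, gradient_apply_eq_fderiv_single, fderiv_theta_single_one hx, smul_eq_mul]
  ring

/-- The cofactor `E + g` is smooth off the ray. [folklore] -/
theorem contDiffAt_cofactor {x : E3} (hx : ‖x‖ ≠ x 2) {n : WithTop ℕ∞} :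
    ContDiffAt ℝ n (fun x : E3 =>
      -2 * ((10 * ‖x‖ - 8 * x 2) / ((‖x‖ - x 2) ^ 2 * (2 * ‖x‖ - x 2))) +
        (x 0 ^ 2 - x 1 ^ 2) * (‖x‖⁻¹ * (10 * ((‖x‖ - x 2) ^ 2 * (2 * ‖x‖ - x 2))⁻¹ +
          (10 * ‖x‖ - 8 * x 2) * (-(((‖x‖ - x 2) ^ 2 * (2 * ‖x‖ - x 2)) ^ 2)⁻¹) *
            (2 * (‖x‖ - x 2) ^ 2 + 2 * ((2 * ‖x‖ - x 2) * (‖x‖ - x 2))))) +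
        6 * ((x 0 ^ 2 - x 1 ^ 2) * (10 * ‖x‖ - 8 * x 2) / ((‖x‖ - x 2) ^ 2 * (2 * ‖x‖ - x 2))) /
          (2 * ‖x‖ - x 2) ^ 2) x := by
  have hle : x 2 ≤ ‖x‖ := (le_abs_self _).trans (by simpa using PiLp.norm_apply_le x 2)
  have h0 : x ≠ 0 := fun h => hx (by rw [h]; simp)
  have h1 : ‖x‖ - x 2 ≠ 0 := sub_ne_zero.2 hx
  have h2 : 2 * ‖x‖ - x 2 ≠ 0 := by
    intro h
    have : ‖x‖ = 0 := by linarith [norm_nonneg x]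
    rw [norm_eq_zero] at this
    exact hx (by rw [this]; simp)
  have hn : ContDiffAt ℝ n (fun y : E3 => ‖y‖) x := contDiffAt_norm ℝ h0
  have hc : ∀ i : Fin 3, ContDiffAt ℝ n (fun y : E3 => y i) x := fun i =>
    (EuclideanSpace.proj i : E3 →L[ℝ] ℝ).contDiff.contDiffAt
  have hm1 : ContDiffAt ℝ n (fun y : E3 => ‖y‖ - y 2) x := hn.sub (hc 2)
  have hm2 : ContDiffAt ℝ n (fun y : E3 => 2 * ‖y‖ - y 2) x := (contDiffAt_const.mul hn).sub (hc 2)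
  have hN : ContDiffAt ℝ n (fun y : E3 => 10 * ‖y‖ - 8 * y 2) x := (contDiffAt_const.mul hn).sub (contDiffAt_const.mul (hc 2))
  have hM : ContDiffAt ℝ n (fun y : E3 => (‖y‖ - y 2) ^ 2 * (2 * ‖y‖ - y 2)) x := (hm1.pow 2).mul hm2
  have hM0 : (‖x‖ - x 2) ^ 2 * (2 * ‖x‖ - x 2) ≠ 0 := mul_ne_zero (pow_ne_zero 2 h1) h2
  have hA : ContDiffAt ℝ n (fun y : E3 => (10 * ‖y‖ - 8 * y 2) / ((‖y‖ - y 2) ^ 2 * (2 * ‖y‖ - y 2))) x := hN.div hM hM0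
  have hQ : ContDiffAt ℝ n (fun y : E3 => y 0 ^ 2 - y 1 ^ 2) x := ((hc 0).pow 2).sub ((hc 1).pow 2)
  have hθ : ContDiffAt ℝ n (fun y : E3 => (y 0 ^ 2 - y 1 ^ 2) * (10 * ‖y‖ - 8 * y 2) /
      ((‖y‖ - y 2) ^ 2 * (2 * ‖y‖ - y 2))) x := (hQ.mul hN).div hM hM0
  have hg : ContDiffAt ℝ n (fun y : E3 => 6 * ((y 0 ^ 2 - y 1 ^ 2) * (10 * ‖y‖ - 8 * y 2) /
      ((‖y‖ - y 2) ^ 2 * (2 * ‖y‖ - y 2))) / (2 * ‖y‖ - y 2) ^ 2) x :=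
    (contDiffAt_const.mul hθ).div (hm2.pow 2) (pow_ne_zero 2 h2)
  have hC : ContDiffAt ℝ n (fun y : E3 => ‖y‖⁻¹ * (10 * ((‖y‖ - y 2) ^ 2 * (2 * ‖y‖ - y 2))⁻¹ +
      (10 * ‖y‖ - 8 * y 2) * (-(((‖y‖ - y 2) ^ 2 * (2 * ‖y‖ - y 2)) ^ 2)⁻¹) *
        (2 * (‖y‖ - y 2) ^ 2 + 2 * ((2 * ‖y‖ - y 2) * (‖y‖ - y 2))))) x :=
    (hn.inv (norm_ne_zero_iff.2 h0)).mul ((contDiffAt_const.mul (hM.inv hM0)).add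
      ((hN.mul ((hM.pow 2).inv (pow_ne_zero 2 hM0)).neg).mul
        ((contDiffAt_const.mul (hm1.pow 2)).add (contDiffAt_const.mul (hm2.mul hm1)))))
  exact ((contDiffAt_const.mul hA).add (hQ.mul hC)).add hg

/-- **The witness is differentiable off the ray** (`θ` is `C²` there, so `∇θ` is `C¹`; `g` is `C¹`). [folklore] -/
theorem differentiableAt_witness {x : E3} (hx : ‖x‖ ≠ x 2) :
    DifferentiableAt ℝ (fun y : E3 =>
      gradient (fun y : E3 => (y 0 ^ 2 - y 1 ^ 2) * (10 * ‖y‖ - 8 * y 2) / ((‖y‖ - y 2) ^ 2 * (2 * ‖y‖ - y 2))) y +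
        (6 * ((y 0 ^ 2 - y 1 ^ 2) * (10 * ‖y‖ - 8 * y 2) / ((‖y‖ - y 2) ^ 2 * (2 * ‖y‖ - y 2))) / (2 * ‖y‖ - y 2) ^ 2) • y)
      x := by
  have hle : x 2 ≤ ‖x‖ := (le_abs_self _).trans (by simpa using PiLp.norm_apply_le x 2)
  have h0 : x ≠ 0 := fun h => hx (by rw [h]; simp)
  have h1 : ‖x‖ - x 2 ≠ 0 := sub_ne_zero.2 hx
  have h2 : 2 * ‖x‖ - x 2 ≠ 0 := by
    intro h
    have : ‖x‖ = 0 := by linarith [norm_nonneg x]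
    rw [norm_eq_zero] at this
    exact hx (by rw [this]; simp)
  have hn : ContDiffAt ℝ 2 (fun y : E3 => ‖y‖) x := contDiffAt_norm ℝ h0
  have hc : ∀ i : Fin 3, ContDiffAt ℝ 2 (fun y : E3 => y i) x := fun i =>
    (EuclideanSpace.proj i : E3 →L[ℝ] ℝ).contDiff.contDiffAt
  have hM0 : (‖x‖ - x 2) ^ 2 * (2 * ‖x‖ - x 2) ≠ 0 := mul_ne_zero (pow_ne_zero 2 h1) h2
  have hθ : ContDiffAt ℝ 2 (fun y : E3 => (y 0 ^ 2 - y 1 ^ 2) * (10 * ‖y‖ - 8 * y 2) /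
      ((‖y‖ - y 2) ^ 2 * (2 * ‖y‖ - y 2))) x :=
    ((((hc 0).pow 2).sub ((hc 1).pow 2)).mul ((contDiffAt_const.mul hn).sub (contDiffAt_const.mul (hc 2)))).div
      (((hn.sub (hc 2)).pow 2).mul ((contDiffAt_const.mul hn).sub (hc 2))) hM0
  have hg : ContDiffAt ℝ 2 (fun y : E3 => 6 * ((y 0 ^ 2 - y 1 ^ 2) * (10 * ‖y‖ - 8 * y 2) /
      ((‖y‖ - y 2) ^ 2 * (2 * ‖y‖ - y 2))) / (2 * ‖y‖ - y 2) ^ 2) x :=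
    (contDiffAt_const.mul hθ).div (((contDiffAt_const.mul hn).sub (hc 2)).pow 2) (pow_ne_zero 2 h2)
  have hG : ContDiffAt ℝ 1 (gradient (fun y : E3 => (y 0 ^ 2 - y 1 ^ 2) * (10 * ‖y‖ - 8 * y 2) /
      ((‖y‖ - y 2) ^ 2 * (2 * ‖y‖ - y 2)))) x := by
    have e : gradient (fun y : E3 => (y 0 ^ 2 - y 1 ^ 2) * (10 * ‖y‖ - 8 * y 2) / ((‖y‖ - y 2) ^ 2 * (2 * ‖y‖ - y 2))) =
        fun y => (InnerProductSpace.toDual ℝ E3).symm (fderiv ℝ (fun y : E3 => (y 0 ^ 2 - y 1 ^ 2) * (10 * ‖y‖ - 8 * y 2) /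
          ((‖y‖ - y 2) ^ 2 * (2 * ‖y‖ - y 2))) y) := rfl
    rw [e]
    exact (InnerProductSpace.toDual ℝ E3).symm.toContinuousLinearEquiv.contDiff.contDiffAt.comp x
      (hθ.fderiv_right (m := 1) (by norm_num))
  exact (hG.differentiableAt one_ne_zero).add ((hg.differentiableAt two_ne_zero).smul differentiableAt_id)

/-- **The Lie derivative of the witness along the rotation at the mirror points**: with `lieJ3 W x = DW(x)(J₃x) − J₃ W(x)`,
`(lieJ3 δv (q_s))₁ = −36 s` — ODD under the reflection `x₀ ↦ −x₀` (the witness is mode 2). [folklore] -/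
theorem lie_witness_apply_one {s : ℝ} (hs : s = 1 ∨ s = -1) :
    (fderiv ℝ (fun y : E3 =>
      gradient (fun y : E3 => (y 0 ^ 2 - y 1 ^ 2) * (10 * ‖y‖ - 8 * y 2) / ((‖y‖ - y 2) ^ 2 * (2 * ‖y‖ - y 2))) y +
        (6 * ((y 0 ^ 2 - y 1 ^ 2) * (10 * ‖y‖ - 8 * y 2) / ((‖y‖ - y 2) ^ 2 * (2 * ‖y‖ - y 2))) / (2 * ‖y‖ - y 2) ^ 2) • y)
      (EuclideanSpace.single 0 (3 * s) + EuclideanSpace.single 2 4 : E3)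
      (J3 (EuclideanSpace.single 0 (3 * s) + EuclideanSpace.single 2 4 : E3))) 1 -
    (J3 ((fun y : E3 =>
      gradient (fun y : E3 => (y 0 ^ 2 - y 1 ^ 2) * (10 * ‖y‖ - 8 * y 2) / ((‖y‖ - y 2) ^ 2 * (2 * ‖y‖ - y 2))) y +
        (6 * ((y 0 ^ 2 - y 1 ^ 2) * (10 * ‖y‖ - 8 * y 2) / ((‖y‖ - y 2) ^ 2 * (2 * ‖y‖ - y 2))) / (2 * ‖y‖ - y 2) ^ 2) • y)
      (EuclideanSpace.single 0 (3 * s) + EuclideanSpace.single 2 4 : E3))) 1 = -36 * s := by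
  set x : E3 := EuclideanSpace.single 0 (3 * s) + EuclideanSpace.single 2 4 with hxdef
  set δv : E3 → E3 := fun y : E3 =>
      gradient (fun y : E3 => (y 0 ^ 2 - y 1 ^ 2) * (10 * ‖y‖ - 8 * y 2) / ((‖y‖ - y 2) ^ 2 * (2 * ‖y‖ - y 2))) y +
        (6 * ((y 0 ^ 2 - y 1 ^ 2) * (10 * ‖y‖ - 8 * y 2) / ((‖y‖ - y 2) ^ 2 * (2 * ‖y‖ - y 2))) / (2 * ‖y‖ - y 2) ^ 2) • y
    with hδv
  set F : E3 → ℝ := fun x : E3 =>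
      -2 * ((10 * ‖x‖ - 8 * x 2) / ((‖x‖ - x 2) ^ 2 * (2 * ‖x‖ - x 2))) +
        (x 0 ^ 2 - x 1 ^ 2) * (‖x‖⁻¹ * (10 * ((‖x‖ - x 2) ^ 2 * (2 * ‖x‖ - x 2))⁻¹ +
          (10 * ‖x‖ - 8 * x 2) * (-(((‖x‖ - x 2) ^ 2 * (2 * ‖x‖ - x 2)) ^ 2)⁻¹) *
            (2 * (‖x‖ - x 2) ^ 2 + 2 * ((2 * ‖x‖ - x 2) * (‖x‖ - x 2))))) +
        6 * ((x 0 ^ 2 - x 1 ^ 2) * (10 * ‖x‖ - 8 * x 2) / ((‖x‖ - x 2) ^ 2 * (2 * ‖x‖ - x 2))) /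
          (2 * ‖x‖ - x 2) ^ 2 with hF
  have hs2 : s ^ 2 = 1 := by rcases hs with rfl | rfl <;> norm_num
  have hr : ‖x‖ = 5 := by
    rw [hxdef, EuclideanSpace.norm_eq, Fin.sum_univ_three]
    simp only [PiLp.add_apply, PiLp.single_apply]
    simp only [Fin.isValue, ↓reduceIte, Fin.reduceEq, add_zero, zero_add, Real.norm_eq_abs, sq_abs]
    rw [show (3 * s) ^ 2 + (0 : ℝ) ^ 2 + 4 ^ 2 = 5 ^ 2 by nlinarith, Real.sqrt_sq (by norm_num)]
  have hx0 : x 0 = 3 * s := by simp [hxdef]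
  have hx1 : x 1 = 0 := by simp [hxdef]
  have hx2 : x 2 = 4 := by simp [hxdef]
  have hray : ‖x‖ ≠ x 2 := by rw [hr, hx2]; norm_num
  have hd : DifferentiableAt ℝ δv x := differentiableAt_witness hray
  have hJ : ∀ v : E3, J3 v = rotGen v := fun v => LandauBase.crossCLM_e2_apply v
  -- component 1 of the derivative is the derivative of component 1
  have hcomp : (fderiv ℝ δv x (J3 x)) 1 = fderiv ℝ (fun y => δv y 1) x (J3 x) := by
    have h := ((EuclideanSpace.proj (1 : Fin 3) : E3 →L[ℝ] ℝ).hasFDerivAt.comp x hd.hasFDerivAt).fderiv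
    have e : (fun y => δv y 1) = (EuclideanSpace.proj (1 : Fin 3) : E3 →L[ℝ] ℝ) ∘ δv := rfl
    rw [e, h]
    rfl
  -- near `x`, component 1 of the witness is `y₁ · F(y)`
  have hev : (fun y => δv y 1) =ᶠ[𝓝 x] fun y => y 1 * F y := by
    filter_upwards [isOpen_offRay.mem_nhds hray] with y hy
    exact witness_apply_one hy
  have hFd : DifferentiableAt ℝ F x := (contDiffAt_cofactor hray (n := 1)).differentiableAt one_ne_zero
  have h1d : DifferentiableAt ℝ (fun y : E3 => y 1) x := (EuclideanSpace.proj (1 : Fin 3) : E3 →L[ℝ] ℝ).differentiableAt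
  have hlin : fderiv ℝ (fun y : E3 => y 1) x = (EuclideanSpace.proj (1 : Fin 3) : E3 →L[ℝ] ℝ) :=
    (EuclideanSpace.proj (1 : Fin 3) : E3 →L[ℝ] ℝ).fderiv
  rw [hcomp, hev.fderiv_eq, fderiv_fun_mul h1d hFd]
  -- the `J₃ δv(x)` term: component 1 of `J₃ v` is `v₀`
  rw [hJ, hJ, rotGen_apply_one]
  simp only [add_apply, smul_apply, smul_eq_mul, hlin, hx1, zero_mul, zero_add]
  have hp1 : (EuclideanSpace.proj (1 : Fin 3) : E3 →L[ℝ] ℝ) (rotGen x) = x 0 := rfl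
  rw [hp1]
  -- component 0 of the witness at `x`
  have hw0 : δv x 0 = fderiv ℝ (fun y : E3 => (y 0 ^ 2 - y 1 ^ 2) * (10 * ‖y‖ - 8 * y 2) /
      ((‖y‖ - y 2) ^ 2 * (2 * ‖y‖ - y 2))) x (EuclideanSpace.single 0 1) +
      6 * ((x 0 ^ 2 - x 1 ^ 2) * (10 * ‖x‖ - 8 * x 2) / ((‖x‖ - x 2) ^ 2 * (2 * ‖x‖ - x 2))) /
          (2 * ‖x‖ - x 2) ^ 2 * x 0 := by
    simp only [hδv, PiLp.add_apply, PiLp.smul_apply, smul_eq_mul, gradient_apply_eq_fderiv_single]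
  rw [hw0, fderiv_theta_apply hray, fderiv_A_apply hray]
  have i0 : ⟪x, (EuclideanSpace.single 0 1 : E3)⟫ = x 0 := by rw [EuclideanSpace.inner_single_right]; simp
  rw [i0]
  simp only [hF, hr, hx0, hx1, hx2, PiLp.single_apply]
  simp only [Fin.isValue, ↓reduceIte, Fin.reduceEq]
  rcases hs with rfl | rfl <;> norm_num

end VertexWitness

end Summit.NavierStokesRegularity.NavierStokesRegularity.Theorems.PoloidalLiouville.AzimuthalCartan
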